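/-
Copyright: the b2b-balaban T⁴-continuum CRUX team, row NE7b OWNER lineage `t4-ne7b-p1` (gen 135). Project licence.
-/
import Summits.QuantumFields.BalabanUV.T4Continuum.Spine.NE7b.SupNextSingletonRegulated
import Mathlib.Analysis.SpecialFunctions.Log.Basic

/-!
# THE ONE-RATE QUADRATIC-FIELD FORMAT DOES NOT ITERATE — (371)'s PRICE MADE A THEOREM: the regulated format `‖g(ω)‖ ≤ εe^{½κΣ_{cell}ω²}` closes
# under ONE step of the road ((371)∕(372)) with a next rate `κ⁺`, and the two windows of that step are
#   (W1) the step's own smallness `hsmall` forces `ε·e^{½κ₁Ψ²} < 1`, i.e. `κ₁Ψ² < 2log(1∕ε)`   (`κ₁ = κ(1+τ⁻¹)`),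
#   (W2) a non-degrading next letter `ε⁺ ≤ ε` forces `e^{−(κ⁺−κ₁)Ψ²∕2} ≤ ε`, i.e. `(κ⁺−κ₁)Ψ² ≥ 2log(1∕ε)`,
# hence `κ⁺ > 2κ₁ ≥ 2κ`: THE RATE AT LEAST DOUBLES PER STEP (same field units).  Along `n` steps `κ_n ≥ 2^n κ_0`; with the road's subcriticality
# `κ_nγ_op,n ≤ θ_n < 1` and field operator norms that do not DECREASE along the scales (`γ_op,n ≥ γ_op,0`: UV → IR shells of a `d = 4` field have
# per-site variance `≍ L^{−2j}` but ℓ²-operator norm `≍ L^{2j}` — the quadratic FIELD regulator is a RELEVANT insertion, exponent `+2`) the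
# format iterates AT MOST `log₂(1∕(κ_0γ_op,0))` times.  This is NC-NE7b-α's analytic half LOCATED as a theorem about the lineage's own currency:
# contraction (indeed mere survival) of the class needs (α1) a MARGINAL regulator (gradients: (375)), (α2) TWO rates (a small format∕stability
# rate, an `O(1)` penalty rate from the Gaussian — the penalty must not be stored in the format, cf. (290)'s `κ ≥ 2κ₀` at the first scale where
# `κ₀ = O(coupling)` is small and `κ = O(1)` is free), (α3) regeneration of the rate by SMOOTHING of the fluctuation covariance instead of Young's
# `(1+τ⁻¹)` — pure real arithmetic on (371)'s displayed constants (row NE7b, node U5c; [folklore])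

Cell `pub-balaban`, sub-cell `t4`, spine estimate NE7b (`T4WeightBudget.RelWeightBound`; the cell's OWN estimate — NOT PRINTED in
[Bałaban 1983–89], NOT PROVED).  Crux-route work under `Spine/NE7b/` by the row OWNER (`t4-ne7b-p1` gen 135, file (374)) under FREEZE
(0)'s crux-prover clause, on `g134/records/SCOPING-d6-iteration.md` DECISION (d6′)(3) («NC-NE7b-α's analytic half: the scaling of the activities
under the road's blocking∕rescaling — where `η` contracts»), answered here in the NEGATIVE for the one-rate field-regulator format with the
obstruction located; NOTHING of Bałaban's is named as a Lean object, valued or asserted; no `T4Continuum/Support` leaf typed; no `def`, no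
notation; zero `sorry`.  Imports (BY NAME): the OWNER's (371) `…SupNextSingletonRegulated` (its constants are quoted verbatim; `one_le_regulatorCost`
through it), Mathlib's `Real.log_le_log`, `Real.log_lt_log`, `Real.log_exp`, `Real.log_pow`.

WHAT IS PROVED ([folklore]; `κ₁ := κ(1+τ⁻¹)`, `ε″ = εe^{½κ₁Ψ²}A_τ^v`, `A_τ = (1−θ)^{−κ(1+τ)γ∕(2θ)} ≥ 1`):
* §1 THE TWO WINDOWS: `eps''_lt_one_of_hsmall` ((371)'s `hsmall` ⟹ `ε″ < 1`), **`window_small`** (⟹ `ε·e^{½κ₁Ψ²} < 1`, hence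
  `½κ₁Ψ² < log(1∕ε)` — `log_window_small`), **`window_large`** (`(1 + SA)·e^{−(κ⁺−κ₁)Ψ²∕2} ≤ δ` with `S, A ≥ 0` ⟹ `e^{−(κ⁺−κ₁)Ψ²∕2} ≤ δ`, hence
  `log(1∕δ) ≤ ½(κ⁺−κ₁)Ψ²` — `log_window_large`);
* §2 THE DOUBLING **`rate_doubling`** (`0 < ε`, `δ ≤ ε`, both windows ⟹ `2κ₁ < κ⁺`), and its reading on (371)'s letter verbatim
  **`rate_doubling_of_nextLetter`** ((371)'s `hsmall` and «the large-field entry of (371)'s `ε⁺` is `≤ ε`» ⟹ `2κ(1+τ⁻¹) < κ⁺`);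
* §3 ALONG THE SCALES: `rate_geometric` (`κ_{j+1} ≥ 2κ_j` ⟹ `κ_n ≥ 2^nκ_0`), THE END **`steps_bounded`** (`κ_nγ_n ≤ θ`, `γ_n ≥ γ_0 > 0`, `κ_0 > 0`
  ⟹ `2^n·(κ_0γ_0) ≤ θ`, so `n ≤ log₂(θ∕(κ_0γ_0))` — `steps_le_log`); §4 toy (with `κ_0γ_0 = 1∕8`, `θ = 1∕2`: at most 2 steps).

HONEST (what this is NOT).  A theorem about the lineage's bookkeeping, not about the model: it says the CURRENCY `e^{½κΣ_{cell}ω²}` (one rate,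
quadratic in the FIELD) cannot carry the road's class along the scales, whatever the constants; it does NOT say the class does not iterate in a
better currency — (375) starts the marginal (gradient) currency, and the two-rate∕smoothing bookkeeping (α2)∕(α3) is the successor's; the
hypothesis `γ_n ≥ γ_0` is the UV → IR ordering of the field shells' operator norms (for the lineage's `d = 4` single-shell letters (284) the per-site
variance falls like `4^{−j}` while the ℓ²-operator norm of the shell grows — not re-derived here, taken as the schedule's hypothesis); scalar skeleton
((A3), NC-NE7b-α UNRULED); nothing of Bałaban's asserted (his regulators are curvature∕covariant-derivative functionals with the two-rate structure
built into the positivity of the Wilson action — exactly (α1)–(α2)).  BY-NAME EFFECT ON THE WALL: NONE.  NE7b NOT PRINTED ∕ NOT PROVED; spine PROVED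
0∕9; rung (B)+1 — the programme's measures remain FINITE-torus statements; NOT the mass gap, NOT Clay.  HONEST DEPENDENCY: continuum YM on T⁴ ⇐
BetaPertH ∧ nine spine estimates (0∕9 proved); BetaPertH ⇐ (D1) ∧ (D4) ∧ CAP+tail; G-an2-4 gates asym, D1 and NE2∕3∕4.
-/

set_option autoImplicit false

noncomputable section

namespace Summit.QuantumFields.BalabanUV.T4Continuum.NE7b.SupFieldRegulatorRelevance

open Finset Real
open scoped BigOperators
open SupRegulatedActivityBound (one_le_regulatorCost)

/-! ## §1. The two windows of one step -/

/-- **(371)'s smallness forces `ε″ < 1`**: `e·(2e(Δ+1)²ε″)·(Δ+1)² ≤ 1∕2`, `0 ≤ ε″` ⟹ `ε″ < 1` (indeed `≤ 1∕(4e²)`). [folklore] -/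
theorem eps''_lt_one_of_hsmall {Δ : ℕ} {e'' : ℝ} (he : 0 ≤ e'')
    (hsmall : Real.exp 1 * (2 * Real.exp 1 * ((Δ : ℝ) + 1) ^ 2 * e'') * ((Δ : ℝ) + 1) ^ 2 ≤ 1 / 2) : e'' < 1 := by
  have hD1 : 1 ≤ ((Δ : ℝ) + 1) ^ 2 := by
    have : (0 : ℝ) ≤ Δ := Nat.cast_nonneg Δ
    nlinarith
  have he1 : 1 ≤ Real.exp 1 := Real.one_le_exp zero_le_one
  -- `e'' ≤ e·(2e·D²·e'')·D² ≤ 1/2`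
  have h1 : e'' ≤ Real.exp 1 * (2 * Real.exp 1 * ((Δ : ℝ) + 1) ^ 2 * e'') * ((Δ : ℝ) + 1) ^ 2 := by
    have h12 : 1 ≤ 2 * Real.exp 1 * ((Δ : ℝ) + 1) ^ 2 := by nlinarith
    have h2 : e'' ≤ 2 * Real.exp 1 * ((Δ : ℝ) + 1) ^ 2 * e'' := le_mul_of_one_le_left he h12
    calc e'' ≤ 2 * Real.exp 1 * ((Δ : ℝ) + 1) ^ 2 * e'' := h2
      _ ≤ Real.exp 1 * (2 * Real.exp 1 * ((Δ : ℝ) + 1) ^ 2 * e'') := le_mul_of_one_le_left (by positivity) he1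
      _ ≤ Real.exp 1 * (2 * Real.exp 1 * ((Δ : ℝ) + 1) ^ 2 * e'') * ((Δ : ℝ) + 1) ^ 2 := le_mul_of_one_le_right (by positivity) hD1
  linarith

/-- **WINDOW (W1) — THE STEP'S SMALLNESS BOUNDS `κ₁Ψ²` FROM ABOVE**: `ε″ = εe^{½κ₁Ψ²}·A^v` with `A ≥ 1`, and (371)'s `hsmall` ⟹ `ε·e^{½κ₁Ψ²} < 1`.
[folklore] -/
theorem window_small {Δ v : ℕ} {ε κ₁ Ψ A : ℝ} (hε : 0 ≤ ε) (hA : 1 ≤ A)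
    (hsmall : Real.exp 1 * (2 * Real.exp 1 * ((Δ : ℝ) + 1) ^ 2 * ((ε * Real.exp (κ₁ * Ψ ^ 2 / 2)) * A ^ v)) * ((Δ : ℝ) + 1) ^ 2 ≤ 1 / 2) :
    ε * Real.exp (κ₁ * Ψ ^ 2 / 2) < 1 := by
  have h0 : 0 ≤ ε * Real.exp (κ₁ * Ψ ^ 2 / 2) := by positivity
  have h1 := eps''_lt_one_of_hsmall (mul_nonneg h0 (pow_nonneg (zero_le_one.trans hA) _)) hsmall
  exact lt_of_le_of_lt (le_mul_of_one_le_right h0 (one_le_pow₀ hA)) h1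

/-- (W1) in logarithmic form: `0 < ε` ⟹ `½κ₁Ψ² < log(1∕ε)`. [folklore] -/
theorem log_window_small {ε κ₁ Ψ : ℝ} (hε : 0 < ε) (h : ε * Real.exp (κ₁ * Ψ ^ 2 / 2) < 1) : κ₁ * Ψ ^ 2 / 2 < Real.log (1 / ε) := by
  have h1 : Real.exp (κ₁ * Ψ ^ 2 / 2) < 1 / ε := by rwa [lt_div_iff₀ hε, mul_comm]
  have h2 := Real.log_lt_log (Real.exp_pos _) h1
  rwa [Real.log_exp] at h2

/-- **WINDOW (W2) — A NON-DEGRADING NEXT LETTER BOUNDS `(κ⁺−κ₁)Ψ²` FROM BELOW**: `(1 + SA)·e^{−(κ⁺−κ₁)Ψ²∕2} ≤ δ` with `0 ≤ SA` ⟹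
`e^{−(κ⁺−κ₁)Ψ²∕2} ≤ δ`. [folklore] -/
theorem window_large {SA κ₁ κ' Ψ δ : ℝ} (hSA : 0 ≤ SA) (h : (1 + SA) * Real.exp (-((κ' - κ₁) * Ψ ^ 2 / 2)) ≤ δ) :
    Real.exp (-((κ' - κ₁) * Ψ ^ 2 / 2)) ≤ δ :=
  (le_mul_of_one_le_left (Real.exp_pos _).le (by linarith)).trans h

/-- (W2) in logarithmic form: `0 < δ` ⟹ `log(1∕δ) ≤ ½(κ⁺−κ₁)Ψ²`. [folklore] -/
theorem log_window_large {κ₁ κ' Ψ δ : ℝ} (hδ : 0 < δ) (h : Real.exp (-((κ' - κ₁) * Ψ ^ 2 / 2)) ≤ δ) :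
    Real.log (1 / δ) ≤ (κ' - κ₁) * Ψ ^ 2 / 2 := by
  have h1 : 1 / δ ≤ Real.exp ((κ' - κ₁) * Ψ ^ 2 / 2) := by
    rw [div_le_iff₀ hδ]
    have h2 : Real.exp (-((κ' - κ₁) * Ψ ^ 2 / 2)) * Real.exp ((κ' - κ₁) * Ψ ^ 2 / 2) = 1 := by
      rw [← Real.exp_add]; simp
    nlinarith [Real.exp_pos ((κ' - κ₁) * Ψ ^ 2 / 2)]
  have h3 := Real.log_le_log (by positivity) h1
  rwa [Real.log_exp] at h3

/-! ## §2. The rate doubles -/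

/-- **THE RATE AT LEAST DOUBLES PER STEP**: `0 < ε`, `0 < δ ≤ ε`, window (W1) `εe^{½κ₁Ψ²} < 1` and window (W2) `e^{−(κ⁺−κ₁)Ψ²∕2} ≤ δ` ⟹
`2κ₁ < κ⁺` (indeed `κ₁Ψ² < 2log(1∕ε) ≤ 2log(1∕δ) ≤ (κ⁺−κ₁)Ψ²`, and `Ψ ≠ 0` by (W2); no sign condition on `κ₁`). [folklore] -/
theorem rate_doubling {ε δ κ₁ κ' Ψ : ℝ} (hε : 0 < ε) (hδ : 0 < δ) (hδε : δ ≤ ε)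
    (hW1 : ε * Real.exp (κ₁ * Ψ ^ 2 / 2) < 1) (hW2 : Real.exp (-((κ' - κ₁) * Ψ ^ 2 / 2)) ≤ δ) : 2 * κ₁ < κ' := by
  have h1 := log_window_small hε hW1
  have h2 := log_window_large hδ hW2
  have h3 : Real.log (1 / ε) ≤ Real.log (1 / δ) :=
    Real.log_le_log (by positivity) (one_div_le_one_div_of_le hδ hδε)
  -- `κ₁Ψ² < (κ' − κ₁)Ψ²`, and `Ψ² > 0` since otherwise (W2) reads `1 ≤ δ ≤ ε < 1`
  have hΨ : 0 < Ψ ^ 2 := by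
    rcases (sq_nonneg Ψ).lt_or_eq with h | h
    · exact h
    · exfalso
      rw [← h] at hW1 hW2
      simp only [mul_zero, zero_div, neg_zero, Real.exp_zero, mul_one] at hW1 hW2
      linarith
  nlinarith

/-- **THE DOUBLING READ ON (371)'s LETTER VERBATIM**: the hypotheses `hsmall` of (371) (with `A_τ = (1−θ)^{−κ(1+τ)γ∕(2θ)}`, `0 ≤ κ`, `0 < τ`, `0 ≤ γ`,
`0 < θ < 1`, `0 < ε`) and «the large-field entry `(1 + S·A_τ^{#cells D})·e^{−(κ⁺−κ₁)Ψ²∕2}` of (371)'s `ε⁺` is `≤ ε`» (`S ≥ 0` the stability constant)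
⟹ `2κ(1+τ⁻¹) < κ⁺`. [folklore] -/
theorem rate_doubling_of_nextLetter {Δ v N : ℕ} {ε κ τ θ γ Ψ κ' S : ℝ} (hε : 0 < ε) (hκ : 0 ≤ κ) (hτ : 0 < τ) (hγ : 0 ≤ γ)
    (hθ0 : 0 < θ) (hθ1 : θ < 1) (hS : 0 ≤ S)
    (hsmall : Real.exp 1 * (2 * Real.exp 1 * ((Δ : ℝ) + 1) ^ 2 *
      ((ε * Real.exp (κ * (1 + τ⁻¹) * Ψ ^ 2 / 2)) * ((1 - θ) ^ (-(κ * (1 + τ) * γ / (2 * θ)))) ^ v)) * ((Δ : ℝ) + 1) ^ 2 ≤ 1 / 2)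
    (hnext : (1 + S * ((1 - θ) ^ (-(κ * (1 + τ) * γ / (2 * θ)))) ^ N) * Real.exp (-((κ' - κ * (1 + τ⁻¹)) * Ψ ^ 2 / 2)) ≤ ε) :
    2 * (κ * (1 + τ⁻¹)) < κ' := by
  have hκγ : 0 ≤ κ * (1 + τ) * γ := by positivity
  have hA1 : 1 ≤ (1 - θ) ^ (-(κ * (1 + τ) * γ / (2 * θ))) := one_le_regulatorCost hκγ hθ0 hθ1
  have hW1 := window_small hε.le hA1 hsmall
  have hSA : 0 ≤ S * ((1 - θ) ^ (-(κ * (1 + τ) * γ / (2 * θ)))) ^ N := mul_nonneg hS (pow_nonneg (zero_le_one.trans hA1) _)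
  have hW2 := window_large hSA hnext
  exact rate_doubling hε hε le_rfl hW1 hW2

/-! ## §3. Along the scales: geometric rates against subcriticality -/

/-- **RATES AT LEAST DOUBLE ⟹ GEOMETRIC GROWTH**: `κ_{j+1} ≥ 2κ_j` for `j < n` ⟹ `κ_n ≥ 2^n·κ_0`. [folklore] -/
theorem rate_geometric (κs : ℕ → ℝ) (n : ℕ) (hstep : ∀ j < n, 2 * κs j ≤ κs (j + 1)) : 2 ^ n * κs 0 ≤ κs n := by
  induction n with
  | zero => simp
  | succ n ih =>
    have h1 := ih fun j hj => hstep j (Nat.lt_succ_of_lt hj)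
    have h2 := hstep n (Nat.lt_succ_self n)
    calc (2 : ℝ) ^ (n + 1) * κs 0 = 2 * (2 ^ n * κs 0) := by ring
      _ ≤ 2 * κs n := by linarith
      _ ≤ κs (n + 1) := h2

/-- **THE END — THE ONE-RATE FIELD FORMAT ITERATES AT MOST LOGARITHMICALLY MANY TIMES**: rates at least doubling (`κ_{j+1} ≥ 2κ_j`), subcriticality
at step `n` (`κ_n·γ_n ≤ θ`) and field operator norms not decreasing (`γ_n ≥ γ_0 > 0`, `κ_0 > 0`) ⟹ `2^n·(κ_0γ_0) ≤ θ`. [folklore] -/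
theorem steps_bounded (κs γs : ℕ → ℝ) {θ : ℝ} (n : ℕ) (hstep : ∀ j < n, 2 * κs j ≤ κs (j + 1)) (hκ0 : 0 < κs 0)
    (hγ0 : 0 < γs 0) (hγ : γs 0 ≤ γs n) (hsub : κs n * γs n ≤ θ) : 2 ^ n * (κs 0 * γs 0) ≤ θ := by
  have h1 := rate_geometric κs n hstep
  have hκn : 0 ≤ κs n := le_trans (by positivity) h1
  calc (2 : ℝ) ^ n * (κs 0 * γs 0) = (2 ^ n * κs 0) * γs 0 := by ring
    _ ≤ κs n * γs 0 := mul_le_mul_of_nonneg_right h1 hγ0.le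
    _ ≤ κs n * γs n := mul_le_mul_of_nonneg_left hγ hκn
    _ ≤ θ := hsub

/-- … in logarithmic form: `n·log 2 ≤ log(θ∕(κ_0γ_0))`, i.e. `n ≤ log₂(θ∕(κ_0γ_0))`. [folklore] -/
theorem steps_le_log (κs γs : ℕ → ℝ) {θ : ℝ} (n : ℕ) (hstep : ∀ j < n, 2 * κs j ≤ κs (j + 1)) (hκ0 : 0 < κs 0)
    (hγ0 : 0 < γs 0) (hγ : γs 0 ≤ γs n) (hsub : κs n * γs n ≤ θ) : (n : ℝ) * Real.log 2 ≤ Real.log (θ / (κs 0 * γs 0)) := by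
  have h := steps_bounded κs γs n hstep hκ0 hγ0 hγ hsub
  have hpos : 0 < κs 0 * γs 0 := mul_pos hκ0 hγ0
  have h1 : (2 : ℝ) ^ n ≤ θ / (κs 0 * γs 0) := by rwa [le_div_iff₀ hpos]
  have h2 := Real.log_le_log (by positivity) h1
  rwa [Real.log_pow] at h2

/-! ## §4. Toy -/

/-- Toy (§3): with `κ_0γ_0 = 1∕8` and `θ = 1∕2`, three doubling steps are already supercritical (`2³·(1∕8) = 1 > 1∕2`): the format carries at
most two steps. -/
example (κs γs : ℕ → ℝ) (hstep : ∀ j < 3, 2 * κs j ≤ κs (j + 1)) (hκ0 : 0 < κs 0) (hγ0 : 0 < γs 0) (hγ : γs 0 ≤ γs 3)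
    (hprod : κs 0 * γs 0 = 1 / 8) : ¬ (κs 3 * γs 3 ≤ 1 / 2) := fun hsub => by
  have h := steps_bounded κs γs 3 hstep hκ0 hγ0 hγ hsub
  rw [hprod] at h
  norm_num at h

end Summit.QuantumFields.BalabanUV.T4Continuum.NE7b.SupFieldRegulatorRelevance
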